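import Summits.NavierStokesRegularity.FunctionalMining.StretchingLaminates
import Mathlib.Tactic.LinearCombination
import Mathlib.Tactic.Linarith
import HarnessLib

/-!
# FunctionalMining — K1-Q1 lamination trees: the NODE CALCULUS as kernel theorems (dict seat, staged)

NS FUNCTIONAL MINING cell (`pub-nsfunc`), dictionary seat gen 8 — **search for candidate a priori
estimates; no regularity claim.** STATIC, finite, rational bookkeeping only: nothing about Navier–Stokes
solutions is asserted anywhere in this file, and no field on the torus appears.

Companion of `StretchingLaminates`. The bank seat's `K1Q1-LAMINATES.md` Lemma 2 ("production and enstrophy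
are CREATED ONLY AT SPLITS") is proved here for the rational tree calculus `Laminate.Tree` of that file:
for a rank-one layer `B = c ⊗ n` with layer vorticity `w = n × c`,

* the layer's own strain annihilates its own vorticity (`S_B w = 0`, an identity in `c, n` — no use of
  `c ⊥ n`), hence the SPLIT IDENTITIES (pure polynomial identities, `ring`):
  `λ·σ(G + (1−λ)B) + (1−λ)·σ(G − λB) = σ(G) + λ(1−λ)·wᵀ S_G w`,
  `λ·½|G + (1−λ)B|² + (1−λ)·½|G − λB|² = ½|G|² + λ(1−λ)·½|c|²|n|²`,
  `λ·|ω(G + (1−λ)B)|² + (1−λ)·|ω(G − λB)|² = |ω(G)|² + λ(1−λ)·|w|²`;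
* by induction on the tree: `stretchFrom G W 𝒯 = W·σ(G) + Σ_splits W_ν λ_ν(1−λ_ν)·w_νᵀ S_{G_ν} w_ν` and
  `energyFrom G W 𝒯 = W·½|G|² + Σ_splits W_ν λ_ν(1−λ_ν)·½|c_ν|²|n_ν|²`; at the root (`G = 0`, `W = 1`):
  **`σ(𝒯) = createdSigma`, `E(𝒯) = createdEnergy`** (`Tree.sigma_eq_createdSigma`, `Tree.energy_eq_createdEnergy`);
* the barycentre bound behind "`M² = max over leaves` suffices": every node state has
  `|ω(G_ν)|² ≤ vortSupFrom G_ν 𝒯_ν` whenever the weights are in `[0,1]` (`Tree.vortSq_le_vortSupFrom`), and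
  `0 ≤ E` along valid trees (`Tree.createdEnergy_nonneg`).

Unit checks on the `board` tree of `StretchingLaminates` (`decide +kernel`). Everything is [ours; elementary
algebra / bookkeeping]; no literature fact is restated (LEAN PLACEMENT RULE).
-/

namespace Summit.NavierStokesRegularity.FunctionalMining

namespace Laminate

namespace Split

/-- Layer vorticity `w = n × c`, component 0 (equals `vort0` of `c ⊗ n`). [ours; bookkeeping] -/
def w0 (s : Split) : ℚ := s.n1 * s.c2 - s.n2 * s.c1

/-- Layer vorticity `w = n × c`, component 1. [ours; bookkeeping] -/
def w1 (s : Split) : ℚ := s.n2 * s.c0 - s.n0 * s.c2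

/-- Layer vorticity `w = n × c`, component 2. [ours; bookkeeping] -/
def w2 (s : Split) : ℚ := s.n0 * s.c1 - s.n1 * s.c0

/-- `|w|²`. [ours; bookkeeping] -/
def wSq (s : Split) : ℚ := s.w0 * s.w0 + s.w1 * s.w1 + s.w2 * s.w2

/-- `|c|²|n|² = |c ⊗ n|²_F`. [ours; bookkeeping] -/
def ampSq (s : Split) : ℚ :=
  (s.c0 * s.c0 + s.c1 * s.c1 + s.c2 * s.c2) * (s.n0 * s.n0 + s.n1 * s.n1 + s.n2 * s.n2)

/-- `c · n` (zero for a div-free split). [ours; bookkeeping] -/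
def dot (s : Split) : ℚ := s.c0 * s.n0 + s.c1 * s.n1 + s.c2 * s.n2

/-- Lagrange's identity `|n × c|² = |c|²|n|² − (c·n)²`. [ours; elementary] -/
theorem wSq_eq (s : Split) : s.wSq = s.ampSq - s.dot * s.dot := by
  simp only [wSq, w0, w1, w2, ampSq, dot]; ring

/-- For a div-free split the created enstrophy density `½|c ⊗ n|²` is half the created vorticity variance
`½|w|²`. [ours; elementary] -/
theorem wSq_eq_ampSq_of_dot (s : Split) (h : s.dot = 0) : s.wSq = s.ampSq := by
  rw [wSq_eq, h]; ring

end Split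

namespace Grad

/-- The quadratic form `vᵀ S_G v` of the strain `S_G = (G + Gᵀ)/2`. [ours; bookkeeping] -/
def quadS (G : Grad) (v0 v1 v2 : ℚ) : ℚ :=
  v0 * v0 * G.g00 + v1 * v1 * G.g11 + v2 * v2 * G.g22 + v0 * v1 * (G.g01 + G.g10)
    + v0 * v2 * (G.g02 + G.g20) + v1 * v2 * (G.g12 + G.g21)

/-- `σ(G) = ωᵀ S_G ω`. [ours; bookkeeping] -/
theorem stretch_eq_quadS (G : Grad) : G.stretch = G.quadS G.vort0 G.vort1 G.vort2 := by
  simp only [stretch, quadS]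

/-- Vorticity is affine along a layer: `ω(G + tB) = ω(G) + t·w`. [ours; elementary] -/
theorem vort0_layer (G : Grad) (t : ℚ) (s : Split) : (G.layer t s).vort0 = G.vort0 + t * s.w0 := by
  simp only [layer, vort0, Split.w0]; ring

/-- Component 1 of `ω(G + tB) = ω(G) + t·w`. [ours; elementary] -/
theorem vort1_layer (G : Grad) (t : ℚ) (s : Split) : (G.layer t s).vort1 = G.vort1 + t * s.w1 := by
  simp only [layer, vort1, Split.w1]; ring

/-- Component 2 of `ω(G + tB) = ω(G) + t·w`. [ours; elementary] -/
theorem vort2_layer (G : Grad) (t : ℚ) (s : Split) : (G.layer t s).vort2 = G.vort2 + t * s.w2 := by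
  simp only [layer, vort2, Split.w2]; ring

/-- **The layer's strain annihilates its own vorticity**: `wᵀ S_B v`-type terms vanish — here in the form
actually used, `quadS` of the pure layer `t·c ⊗ n` (state `0`) evaluated at `w` is `0`, for ALL `c, n`.
[ours; elementary] -/
theorem quadS_layer_self (t : ℚ) (s : Split) : (Grad.zero.layer t s).quadS s.w0 s.w1 s.w2 = 0 := by
  simp only [zero, layer, quadS, Split.w0, Split.w1, Split.w2]; ring

/-- **Split identity for the production** (bank Lemma 2(i)):
`λ·σ(G + (1−λ)B) + (1−λ)·σ(G − λB) = σ(G) + λ(1−λ)·wᵀ S_G w`, unconditionally in `c, n`. [ours; elementary] -/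
theorem stretch_split (G : Grad) (s : Split) :
    s.lam * (G.layer (1 - s.lam) s).stretch + (1 - s.lam) * (G.layer (-s.lam) s).stretch
      = G.stretch + s.lam * (1 - s.lam) * G.quadS s.w0 s.w1 s.w2 := by
  simp only [stretch, layer, vort0, vort1, vort2, quadS, Split.w0, Split.w1, Split.w2]; ring

/-- **Split identity for the enstrophy** (bank Lemma 2(ii)):
`λ·½|G + (1−λ)B|² + (1−λ)·½|G − λB|² = ½|G|² + λ(1−λ)·½|c|²|n|²`. [ours; elementary] -/
theorem halfGradSq_split (G : Grad) (s : Split) :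
    s.lam * (G.layer (1 - s.lam) s).halfGradSq + (1 - s.lam) * (G.layer (-s.lam) s).halfGradSq
      = G.halfGradSq + s.lam * (1 - s.lam) * (s.ampSq / 2) := by
  simp only [halfGradSq, layer, Split.ampSq]; ring

/-- **Split identity for `|ω|²`**: `λ|ω(G₊)|² + (1−λ)|ω(G₋)|² = |ω(G)|² + λ(1−λ)|w|²` — the node vorticity is
the barycentre of its children's. [ours; elementary] -/
theorem vortSq_split (G : Grad) (s : Split) :
    s.lam * (G.layer (1 - s.lam) s).vortSq + (1 - s.lam) * (G.layer (-s.lam) s).vortSq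
      = G.vortSq + s.lam * (1 - s.lam) * s.wSq := by
  simp only [vortSq, vort0_layer, vort1_layer, vort2_layer, Split.wSq]; ring

/-- `|ω|² ≥ 0`. [ours; bookkeeping] -/
theorem vortSq_nonneg (G : Grad) : 0 ≤ G.vortSq :=
  add_nonneg (add_nonneg (mul_self_nonneg _) (mul_self_nonneg _)) (mul_self_nonneg _)

/-- Barycentre bound: for `λ ∈ [0,1]`, `|ω(G)|² ≤ max(|ω(G₊)|², |ω(G₋)|²)` (stated without `max`).
[ours; elementary] -/
theorem vortSq_le_of_split (G : Grad) (s : Split) (h0 : 0 ≤ s.lam) (h1 : s.lam ≤ 1) {M : ℚ}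
    (hp : (G.layer (1 - s.lam) s).vortSq ≤ M) (hm : (G.layer (-s.lam) s).vortSq ≤ M) : G.vortSq ≤ M := by
  have hid := vortSq_split G s
  have hw : 0 ≤ s.wSq := add_nonneg (add_nonneg (mul_self_nonneg _) (mul_self_nonneg _)) (mul_self_nonneg _)
  have hprod : 0 ≤ s.lam * (1 - s.lam) * s.wSq :=
    mul_nonneg (mul_nonneg h0 (by linarith)) hw
  have h2 : s.lam * (G.layer (1 - s.lam) s).vortSq ≤ s.lam * M := mul_le_mul_of_nonneg_left hp h0
  have h3 : (1 - s.lam) * (G.layer (-s.lam) s).vortSq ≤ (1 - s.lam) * M :=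
    mul_le_mul_of_nonneg_left hm (by linarith)
  nlinarith

end Grad

namespace Tree

/-- Production CREATED at the splits below a node in state `G` with weight `W`:
`Σ_ν W_ν λ_ν(1−λ_ν) · w_νᵀ S_{G_ν} w_ν`. [ours; bookkeeping] -/
def createdSigma (G : Grad) (W : ℚ) : Tree → ℚ
  | leaf => 0
  | node s p m => W * (s.lam * (1 - s.lam)) * G.quadS s.w0 s.w1 s.w2
      + createdSigma (G.layer (1 - s.lam) s) (W * s.lam) p
      + createdSigma (G.layer (-s.lam) s) (W * (1 - s.lam)) m

/-- Enstrophy CREATED at the splits: `Σ_ν W_ν λ_ν(1−λ_ν) · ½|c_ν|²|n_ν|²` (independent of the states).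
[ours; bookkeeping] -/
def createdEnergy (W : ℚ) : Tree → ℚ
  | leaf => 0
  | node s p m => W * (s.lam * (1 - s.lam)) * (s.ampSq / 2)
      + createdEnergy (W * s.lam) p + createdEnergy (W * (1 - s.lam)) m

/-- **Node calculus, production**: `stretchFrom G W 𝒯 = W·σ(G) + createdSigma G W 𝒯`. [ours; elementary] -/
theorem stretchFrom_eq (T : Tree) : ∀ (G : Grad) (W : ℚ), T.stretchFrom G W = W * G.stretch + T.createdSigma G W := by
  induction T with
  | leaf => intro G W; simp [stretchFrom, createdSigma]
  | node s p m ihp ihm =>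
      intro G W
      simp only [stretchFrom, createdSigma, ihp, ihm]
      have h := Grad.stretch_split G s
      linear_combination W * h

/-- **Node calculus, enstrophy**: `energyFrom G W 𝒯 = W·½|G|² + createdEnergy W 𝒯`. [ours; elementary] -/
theorem energyFrom_eq (T : Tree) : ∀ (G : Grad) (W : ℚ), T.energyFrom G W = W * G.halfGradSq + T.createdEnergy W := by
  induction T with
  | leaf => intro G W; simp [energyFrom, createdEnergy]
  | node s p m ihp ihm =>
      intro G W
      simp only [energyFrom, createdEnergy, ihp, ihm]
      have h := Grad.halfGradSq_split G s
      linear_combination W * h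

/-- `σ(0) = 0`. [ours; bookkeeping] -/
theorem stretch_zero : Grad.zero.stretch = 0 := by simp [Grad.zero, Grad.stretch, Grad.vort0, Grad.vort1, Grad.vort2]

/-- `½|0|² = 0`. [ours; bookkeeping] -/
theorem halfGradSq_zero : Grad.zero.halfGradSq = 0 := by simp [Grad.zero, Grad.halfGradSq]

/-- **`σ(𝒯)` is the production created at the splits** (bank Lemma 2(i) at the root). [ours; elementary] -/
theorem sigma_eq_createdSigma (T : Tree) : T.sigma = T.createdSigma Grad.zero 1 := by
  rw [sigma, stretchFrom_eq, stretch_zero]; ring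

/-- **`E(𝒯)` is the enstrophy created at the splits** (bank Lemma 2(ii) at the root); in particular `E`
depends only on the weights, the `λ_ν` and the amplitudes `|c_ν|²|n_ν|²`. [ours; elementary] -/
theorem energy_eq_createdEnergy (T : Tree) : T.energy = T.createdEnergy 1 := by
  rw [energy, energyFrom_eq, halfGradSq_zero]; ring

/-- The validity flag of a node, unpacked. [ours; bookkeeping] -/
theorem valid_node {s : Split} {p m : Tree} (h : (node s p m).valid = true) :
    0 < s.lam ∧ s.lam < 1 ∧ s.dot = 0 ∧ p.valid = true ∧ m.valid = true := by
  simp only [valid, Bool.and_eq_true, decide_eq_true_eq] at h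
  exact ⟨h.1.1.1.1, h.1.1.1.2, h.1.1.2, h.1.2, h.2⟩

/-- Created enstrophy is nonnegative along a valid tree with nonnegative weight. [ours; elementary] -/
theorem createdEnergy_nonneg (T : Tree) (hT : T.valid = true) : ∀ {W : ℚ}, 0 ≤ W → 0 ≤ T.createdEnergy W := by
  induction T with
  | leaf => intro W _; simp [createdEnergy]
  | node s p m ihp ihm =>
      intro W hW
      obtain ⟨h0, h1, -, hp, hm⟩ := valid_node hT
      simp only [createdEnergy]
      have ha : 0 ≤ s.ampSq :=
        mul_nonneg (add_nonneg (add_nonneg (mul_self_nonneg _) (mul_self_nonneg _)) (mul_self_nonneg _))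
          (add_nonneg (add_nonneg (mul_self_nonneg _) (mul_self_nonneg _)) (mul_self_nonneg _))
      have h1' : 0 ≤ 1 - s.lam := by linarith
      have hl : 0 ≤ s.lam * (1 - s.lam) := mul_nonneg h0.le h1'
      have t1 : 0 ≤ W * (s.lam * (1 - s.lam)) * (s.ampSq / 2) :=
        mul_nonneg (mul_nonneg hW hl) (by linarith)
      have t2 := ihp hp (W := W * s.lam) (mul_nonneg hW h0.le)
      have t3 := ihm hm (W := W * (1 - s.lam)) (mul_nonneg hW h1')
      linarith

/-- `0 ≤ E(𝒯)` for every valid tree. [ours; elementary] -/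
theorem energy_nonneg_of_valid (T : Tree) (hT : T.valid = true) : 0 ≤ T.energy := by
  rw [energy_eq_createdEnergy]; exact createdEnergy_nonneg T hT zero_le_one

/-- **Barycentre bound along the tree**: the state at a node has `|ω(G)|² ≤ vortSupFrom G 𝒯` (the max over
the leaves below it) whenever all weights lie in `[0,1]` — so bounding `|ω|²` over LEAVES bounds it over all
node states too. [ours; elementary] -/
theorem vortSq_le_vortSupFrom (T : Tree) (hT : T.valid = true) : ∀ G : Grad, G.vortSq ≤ T.vortSupFrom G := by
  induction T with
  | leaf => intro G; simp [vortSupFrom]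
  | node s p m ihp ihm =>
      intro G
      obtain ⟨h0, h1, -, hp, hm⟩ := valid_node hT
      have hP := ihp hp (G.layer (1 - s.lam) s)
      have hM := ihm hm (G.layer (-s.lam) s)
      simp only [vortSupFrom]
      split_ifs with hle
      · exact Grad.vortSq_le_of_split G s h0.le h1.le (hP.trans hle) hM
      · exact Grad.vortSq_le_of_split G s h0.le h1.le hP (hM.trans (le_of_lt (lt_of_not_ge hle)))

/-! ## Unit checks on the `board` tree of `StretchingLaminates` -/

/-- The board's production is created at its splits: `createdSigma 0 1 board = 1/4`. [ours; bookkeeping] -/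
theorem board_createdSigma : board.createdSigma Grad.zero 1 = 1 / 4 := by decide +kernel

/-- The board's enstrophy is created at its splits: `createdEnergy 1 board = 1/2`. [ours; bookkeeping] -/
theorem board_createdEnergy : board.createdEnergy 1 = 1 / 2 := by decide +kernel

end Tree

end Laminate

end Summit.NavierStokesRegularity.FunctionalMining
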